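import Summits.CriticalPhenomena.CardyFormulaZ2.Theorems.CardyUSTContinuationKirchhoffExtremalLengthSlope
import Literature.Probability.LatticeModels.EffectiveResistanceProofs

/-!
# Kirchhoff's theorem for the uniform-spanning-tree limit of the jointly wired FK model, I:
# minimal and next-to-minimal configurations

Support file for `KirchhoffExtremalLength` (route CardyUSTContinuation of `CardyFormulaZ2`,
item stmt-CriticalPhenomena-11234). On a finite graph `G` with a wired vertex set `W` consider
the exponent `E(ω) = |ω| + 2 k^W(ω)` of a configuration `ω ⊆ E(G)` (`k^W` = `clusterCount`, the
number of clusters with `W` wired) and its minimum `m`. This file proves the structure of the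
minimisers (the spanning trees of `G/W`, Grimmett 2006 Thm 1.23) in the form needed for
Kirchhoff's theorem: a minimiser joins the endpoints of every edge of `G` (with the wiring), each
of its edges is a bridge (even with the wiring), every vertex has at most one — and, if joined to
`W` in `G`, exactly one — vertex of `W` in its open cluster; and for a configuration of exponent
`m + 1` containing an open crossing between two disjoint parts `B₁, B₂` of `W = B₁ ∪ B₂`, every
vertex is joined by open paths to at most one vertex of `B₁` and at most one of `B₂`.
-/

noncomputable section

namespace Summit.CriticalPhenomena.CardyFormulaZ2.Theorems

namespace KirchhoffSlope

open Finset SimpleGraph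
open Literature.Probability.LatticeModels Literature.Probability.Percolation

variable {V : Type*}

/-! ### §1. Counting connected components -/

/-- If `H' ≤ H` and every edge of `H` joins `H'`-connected vertices, then `H` and `H'` have the
same connected components. [folklore] -/
theorem card_connectedComponent_eq_of_adj_reachable {H H' : SimpleGraph V} (hle : H' ≤ H)
    (h : ∀ x y, H.Adj x y → H'.Reachable x y) :
    Nat.card H'.ConnectedComponent = Nat.card H.ConnectedComponent := by
  have key : ∀ x y, H.Reachable x y → H'.Reachable x y := fun x y hxy =>
    reachable_le_of_adj_le (r := H'.Reachable) (fun _ => Reachable.refl _)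
      (fun _ _ _ => Reachable.trans) h hxy
  refine Nat.card_congr (Equiv.ofBijective (ConnectedComponent.map (Hom.ofLE hle))
    ⟨?_, ConnectedComponent.surjective_map_ofLE hle⟩)
  refine ConnectedComponent.ind₂ fun x y hxy => ?_
  simp only [ConnectedComponent.map_mk, Hom.coe_ofLE, id_eq, ConnectedComponent.eq] at hxy
  exact ConnectedComponent.sound (key x y hxy)

/-- **Joining two components by an edge removes exactly one component** (finite vertex set).
[folklore] -/
theorem card_connectedComponent_sup_edge_add_one [Finite V] {H : SimpleGraph V} {u v : V}
    (huv : ¬ H.Reachable u v) :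
    Nat.card (H ⊔ edge u v).ConnectedComponent + 1 = Nat.card H.ConnectedComponent := by
  classical
  set Gj := H ⊔ edge u v with hGj
  have hle : H ≤ Gj := le_sup_left
  set φ : H.ConnectedComponent → Gj.ConnectedComponent := ConnectedComponent.map (Hom.ofLE hle)
    with hφdef
  have hφ : Function.Surjective φ := ConnectedComponent.surjective_map_ofLE hle
  set c₁ := H.connectedComponentMk u with hc₁
  set c₂ := H.connectedComponentMk v with hc₂
  have hne : c₁ ≠ c₂ := fun h => huv (ConnectedComponent.exact h)
  have huv' : u ≠ v := fun h => huv (h ▸ Reachable.refl _)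
  have hφ₁₂ : φ c₁ = φ c₂ := by
    simp only [hc₁, hc₂, hφdef, ConnectedComponent.map_mk, Hom.coe_ofLE, id_eq,
      ConnectedComponent.eq]
    exact Adj.reachable ((sup_adj _ _ _ _).2 (Or.inr ((edge_adj _ _ _ _).2 ⟨Or.inl ⟨rfl, rfl⟩, huv'⟩)))
  -- `ψ` merges `c₂` into `c₁`
  set ψ : H.ConnectedComponent → H.ConnectedComponent := fun d => if d = c₂ then c₁ else d
    with hψdef
  have hφψ : ∀ d, φ (ψ d) = φ d := fun d => by
    by_cases hd : d = c₂
    · simp only [hψdef, hd, if_true, hφ₁₂]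
    · simp only [hψdef, hd, if_false]
  have hψu : ψ (H.connectedComponentMk u) = c₁ := by
    simp only [hψdef]; rw [if_neg hne]
  have hψv : ψ (H.connectedComponentMk v) = c₁ := by
    simp only [hψdef]; rw [if_pos rfl]
  have key : ∀ x y, Gj.Reachable x y →
      ψ (H.connectedComponentMk x) = ψ (H.connectedComponentMk y) := by
    intro x y hxy
    refine reachable_le_of_adj_le
      (r := fun x y => ψ (H.connectedComponentMk x) = ψ (H.connectedComponentMk y))
      (fun _ => rfl) (fun _ _ _ h1 h2 => h1.trans h2) ?_ hxy
    rintro x y hxy'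
    rcases (sup_adj _ _ _ _).1 hxy' with hxy' | hxy'
    · rw [ConnectedComponent.sound hxy'.reachable]
    · rcases ((edge_adj _ _ _ _).1 hxy').1 with ⟨rfl, rfl⟩ | ⟨rfl, rfl⟩
      · rw [hψu, hψv]
      · rw [hψu, hψv]
  have hinj : ∀ d d', φ d = φ d' → ψ d = ψ d' := by
    refine ConnectedComponent.ind₂ fun x y hxy => ?_
    apply key
    simpa only [hφdef, ConnectedComponent.map_mk, Hom.coe_ofLE, id_eq,
      ConnectedComponent.eq] using hxy
  have hψne : ∀ d, ψ d ≠ c₂ := fun d => by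
    change (if d = c₂ then c₁ else d) ≠ c₂
    by_cases hd : d = c₂
    · rw [if_pos hd]; exact hne
    · rw [if_neg hd]; exact hd
  let e : Gj.ConnectedComponent ≃ {d : H.ConnectedComponent // d ≠ c₂} :=
    { toFun := fun q => ⟨ψ (Function.surjInv hφ q), hψne _⟩
      invFun := fun d => φ d.1
      left_inv := fun q => by simp only; rw [hφψ, Function.surjInv_eq hφ]
      right_inv := fun d => by
        ext
        simp only
        rw [hinj _ _ (Function.surjInv_eq hφ (φ d.1))]
        simp only [hψdef, d.2, if_false] }
  have hcard : Nat.card {d : H.ConnectedComponent // d ≠ c₂} + 1 =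
      Nat.card H.ConnectedComponent := by
    have h := Set.ncard_add_ncard_compl ({c₂} : Set H.ConnectedComponent)
    rw [Set.ncard_singleton, ← Nat.card_coe_set_eq, add_comm] at h
    exact h
  rw [← hcard, Nat.card_congr e]

variable [DecidableEq V]

/-- The wired open graph of `ω ∖ e` is a subgraph of that of `ω`. [folklore] -/
theorem wiredOpenGraph_erase_le (ω : Finset (Sym2 V)) (e : Sym2 V) (W : Set V) :
    openGraph (↑(ω.erase e) : BondConfig V) ⊔ wired W ≤ openGraph (↑ω : BondConfig V) ⊔ wired W :=
  sup_le_sup_right (openGraph_mono (Finset.coe_subset.2 (Finset.erase_subset _ _))) _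

/-- **Removing an edge whose endpoints stay joined (with the wiring) keeps the wired cluster
count.** [folklore] -/
theorem clusterCount_erase_eq_of_reachable {ω : Finset (Sym2 V)} {W : Set V} {u v : V}
    (h : (openGraph (↑(ω.erase s(u, v)) : BondConfig V) ⊔ wired W).Reachable u v) :
    clusterCount (↑(ω.erase s(u, v)) : BondConfig V) W = clusterCount (↑ω : BondConfig V) W := by
  refine card_connectedComponent_eq_of_adj_reachable (wiredOpenGraph_erase_le ω _ W) ?_
  rintro x y (hxy | hxy)
  · obtain ⟨hm, hn⟩ := (openGraph_adj _ _ _).1 hxy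
    by_cases he : s(x, y) = s(u, v)
    · rw [Sym2.eq_iff] at he
      rcases he with ⟨rfl, rfl⟩ | ⟨rfl, rfl⟩
      · exact h
      · exact h.symm
    · refine Adj.reachable (le_sup_left (α := SimpleGraph V) ?_)
      refine (openGraph_adj _ _ _).2 ⟨?_, hn⟩
      rw [Finset.mem_coe, Finset.mem_erase]
      exact ⟨he, hm⟩
  · exact ((le_sup_right : wired W ≤ _) hxy).reachable

/-- The wired open graph of `insert s(u,v) ω` is that of `ω` with the edge `uv` added. [folklore] -/
theorem wiredOpenGraph_insert (ω : Finset (Sym2 V)) (W : Set V) (u v : V) :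
    openGraph (↑(insert s(u, v) ω) : BondConfig V) ⊔ wired W =
      (openGraph (↑ω : BondConfig V) ⊔ wired W) ⊔ edge u v := by
  rw [Finset.coe_insert, openGraph, openGraph, Set.insert_eq, fromEdgeSet_union, edge]
  ac_rfl

/-- **Adding an edge of `G` between two wired clusters removes exactly one cluster.**
[folklore] -/
theorem clusterCount_insert_add_one [Finite V] {ω : Finset (Sym2 V)} {W : Set V} {u v : V}
    (h : ¬ (openGraph (↑ω : BondConfig V) ⊔ wired W).Reachable u v) :
    clusterCount (↑(insert s(u, v) ω) : BondConfig V) W + 1 = clusterCount (↑ω : BondConfig V) W := by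
  rw [clusterCount, clusterCount, wiredOpenGraph_insert]
  exact card_connectedComponent_sup_edge_add_one h

/-- **Adding an edge inside a wired cluster keeps the cluster count.** [folklore] -/
theorem clusterCount_insert_eq_of_reachable {ω : Finset (Sym2 V)} {W : Set V} {u v : V}
    (h : (openGraph (↑ω : BondConfig V) ⊔ wired W).Reachable u v) :
    clusterCount (↑(insert s(u, v) ω) : BondConfig V) W = clusterCount (↑ω : BondConfig V) W := by
  rw [clusterCount, clusterCount, wiredOpenGraph_insert]
  refine (card_connectedComponent_eq_of_adj_reachable le_sup_left ?_).symm
  rintro x y hxy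
  rcases (sup_adj _ _ _ _).1 hxy with hxy | hxy
  · exact hxy.reachable
  · rcases ((edge_adj _ _ _ _).1 hxy).1 with ⟨rfl, rfl⟩ | ⟨rfl, rfl⟩
    · exact h
    · exact h.symm

/-! ### §2. Walks: the first wired vertex; reachability across a removed edge -/

omit [DecidableEq V] in
/-- Along a walk of the wired open graph ending in `W`, the initial open segment reaches a vertex
of `W`. [folklore] -/
theorem exists_open_reachable_of_walk {ω : Finset (Sym2 V)} {W : Set V} :
    ∀ {v u : V} (_ : (openGraph (↑ω : BondConfig V) ⊔ wired W).Walk v u), u ∈ W →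
      ∃ u' ∈ W, (openGraph (↑ω : BondConfig V)).Reachable v u' := by
  intro v u p
  induction p with
  | nil => exact fun hu => ⟨_, hu, Reachable.refl _⟩
  | cons hadj _ ih =>
    intro hu
    obtain ⟨u', hu', hr⟩ := ih hu
    rcases hadj with hadj | hadj
    · exact ⟨u', hu', hadj.reachable.trans hr⟩
    · rw [wired_adj] at hadj
      exact ⟨_, hadj.2.1, Reachable.refl _⟩

/-- **Reachability across a removed edge.** An open walk from `y` to `z` either avoids the edge
`uv`, or splits at it: `y` reaches one endpoint and the other endpoint reaches `z`, all in
`ω ∖ uv`. [folklore] -/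
theorem reachable_erase_trichotomy {ω : Finset (Sym2 V)} {u v : V} :
    ∀ {y z : V} (_ : (openGraph (↑ω : BondConfig V)).Walk y z),
      (openGraph (↑(ω.erase s(u, v)) : BondConfig V)).Reachable y z ∨
      ((openGraph (↑(ω.erase s(u, v)) : BondConfig V)).Reachable y u ∧
        (openGraph (↑(ω.erase s(u, v)) : BondConfig V)).Reachable v z) ∨
      ((openGraph (↑(ω.erase s(u, v)) : BondConfig V)).Reachable y v ∧
        (openGraph (↑(ω.erase s(u, v)) : BondConfig V)).Reachable u z) := by
  intro y z q
  induction q with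
  | nil => exact Or.inl (Reachable.refl _)
  | @cons y y' z hyy' q' ih =>
    obtain ⟨hmem, hne⟩ := (openGraph_adj _ _ _).1 hyy'
    by_cases he : s(y, y') = s(u, v)
    · rw [Sym2.eq_iff] at he
      rcases he with ⟨rfl, rfl⟩ | ⟨rfl, rfl⟩
      · -- `y = u`, `y' = v`
        rcases ih with h | ⟨h1, h2⟩ | ⟨h1, h2⟩
        · exact Or.inr (Or.inl ⟨Reachable.refl _, h⟩)
        · exact Or.inr (Or.inl ⟨Reachable.refl _, h2⟩)
        · exact Or.inl h2
      · -- `y = v`, `y' = u`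
        rcases ih with h | ⟨h1, h2⟩ | ⟨h1, h2⟩
        · exact Or.inr (Or.inr ⟨Reachable.refl _, h⟩)
        · exact Or.inl h2
        · exact Or.inr (Or.inr ⟨Reachable.refl _, h2⟩)
    · have hadj : (openGraph (↑(ω.erase s(u, v)) : BondConfig V)).Adj y y' := by
        refine (openGraph_adj _ _ _).2 ⟨?_, hne⟩
        rw [Finset.mem_coe, Finset.mem_erase]
        exact ⟨he, hmem⟩
      rcases ih with h | ⟨h1, h2⟩ | ⟨h1, h2⟩
      · exact Or.inl (hadj.reachable.trans h)
      · exact Or.inr (Or.inl ⟨hadj.reachable.trans h1, h2⟩)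
      · exact Or.inr (Or.inr ⟨hadj.reachable.trans h1, h2⟩)

omit [DecidableEq V] in
/-- The open graph of a set of edges of `G` is a subgraph of `G`. [folklore] -/
theorem openGraph_le_of_subset [Fintype V] {G : SimpleGraph V} [DecidableRel G.Adj]
    {ω : Finset (Sym2 V)} (hω : ω ⊆ G.edgeFinset) : openGraph (↑ω : BondConfig V) ≤ G := by
  intro x y hxy
  obtain ⟨hmem, -⟩ := (openGraph_adj _ _ _).1 hxy
  exact mem_edgeFinset.1 (hω hmem)


/-! ### §3. Minimal configurations -/

section Minimal

variable [Fintype V] {G : SimpleGraph V} [DecidableRel G.Adj] {W : Set V} {m : ℕ}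

/-- **An open crossing between two distinct wired vertices costs one unit of exponent**: if `m`
bounds all exponents from below, a configuration joining `a ≠ b ∈ W` by an open path has exponent
`≥ m + 1` (remove the first edge of the crossing, `exists_erase_clusterCount_eq`). [folklore] -/
theorem succ_le_exponent_of_reachable
    (hm : ∀ ω ⊆ G.edgeFinset, m ≤ #ω + 2 * clusterCount (↑ω : BondConfig V) W)
    {ω : Finset (Sym2 V)} (hω : ω ⊆ G.edgeFinset) {a b : V} (ha : a ∈ W) (hb : b ∈ W) (hab : a ≠ b)
    (h : (openGraph (↑ω : BondConfig V)).Reachable a b) :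
    m + 1 ≤ #ω + 2 * clusterCount (↑ω : BondConfig V) W := by
  obtain ⟨e, he, hk⟩ := exists_erase_clusterCount_eq ha hb hab h
  have h1 := hm _ ((Finset.erase_subset e ω).trans hω)
  rw [hk, Finset.card_erase_of_mem he] at h1
  have hpos : 0 < #ω := Finset.card_pos.2 ⟨e, he⟩
  omega

/-- **A minimiser joins (with the wiring) the endpoints of every edge of `G`**: otherwise adding
that edge would lower the exponent by one. [folklore] -/
theorem reachable_of_adj_of_minimal
    (hm : ∀ ω ⊆ G.edgeFinset, m ≤ #ω + 2 * clusterCount (↑ω : BondConfig V) W)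
    {ω : Finset (Sym2 V)} (hω : ω ⊆ G.edgeFinset) (hE : #ω + 2 * clusterCount (↑ω : BondConfig V) W = m)
    {u v : V} (huv : G.Adj u v) :
    (openGraph (↑ω : BondConfig V) ⊔ wired W).Reachable u v := by
  by_contra h
  have he : s(u, v) ∉ ω := fun he =>
    h (Adj.reachable (le_sup_left (α := SimpleGraph V) ((openGraph_adj _ _ _).2 ⟨he, huv.ne⟩)))
  have hsub : insert s(u, v) ω ⊆ G.edgeFinset := Finset.insert_subset (mem_edgeFinset.2 huv) hω
  have h1 := hm _ hsub
  have h2 := clusterCount_insert_add_one (W := W) h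
  rw [Finset.card_insert_of_notMem he] at h1
  omega

/-- A minimiser joins (with the wiring) any two vertices joined in `G`. [folklore] -/
theorem reachable_of_reachable_of_minimal
    (hm : ∀ ω ⊆ G.edgeFinset, m ≤ #ω + 2 * clusterCount (↑ω : BondConfig V) W)
    {ω : Finset (Sym2 V)} (hω : ω ⊆ G.edgeFinset) (hE : #ω + 2 * clusterCount (↑ω : BondConfig V) W = m)
    {u v : V} (huv : G.Reachable u v) :
    (openGraph (↑ω : BondConfig V) ⊔ wired W).Reachable u v :=
  reachable_le_of_adj_le (r := (openGraph (↑ω : BondConfig V) ⊔ wired W).Reachable)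
    (fun _ => Reachable.refl _) (fun _ _ _ => Reachable.trans)
    (fun _ _ h => reachable_of_adj_of_minimal hm hω hE h) huv

/-- **Every edge of a minimiser is a bridge, even with the wiring**: otherwise removing it would
lower the exponent by one. [folklore] -/
theorem not_reachable_erase_of_minimal
    (hm : ∀ ω ⊆ G.edgeFinset, m ≤ #ω + 2 * clusterCount (↑ω : BondConfig V) W)
    {ω : Finset (Sym2 V)} (hω : ω ⊆ G.edgeFinset) (hE : #ω + 2 * clusterCount (↑ω : BondConfig V) W = m)
    {u v : V} (he : s(u, v) ∈ ω) :
    ¬ (openGraph (↑(ω.erase s(u, v)) : BondConfig V) ⊔ wired W).Reachable u v := by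
  intro h
  have h1 := clusterCount_erase_eq_of_reachable h
  have h2 := hm _ ((Finset.erase_subset s(u, v) ω).trans hω)
  rw [h1, Finset.card_erase_of_mem he] at h2
  have hpos : 0 < #ω := Finset.card_pos.2 ⟨_, he⟩
  omega

/-- **In a minimiser, distinct wired vertices are not joined by an open path.** [folklore] -/
theorem not_reachable_of_minimal
    (hm : ∀ ω ⊆ G.edgeFinset, m ≤ #ω + 2 * clusterCount (↑ω : BondConfig V) W)
    {ω : Finset (Sym2 V)} (hω : ω ⊆ G.edgeFinset) (hE : #ω + 2 * clusterCount (↑ω : BondConfig V) W = m)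
    {a b : V} (ha : a ∈ W) (hb : b ∈ W) (hab : a ≠ b) :
    ¬ (openGraph (↑ω : BondConfig V)).Reachable a b := fun h => by
  have := succ_le_exponent_of_reachable hm hω ha hb hab h
  omega

/-- **In a minimiser every vertex reaches at most one wired vertex by open paths** (its root).
[folklore] -/
theorem root_unique_of_minimal
    (hm : ∀ ω ⊆ G.edgeFinset, m ≤ #ω + 2 * clusterCount (↑ω : BondConfig V) W)
    {ω : Finset (Sym2 V)} (hω : ω ⊆ G.edgeFinset) (hE : #ω + 2 * clusterCount (↑ω : BondConfig V) W = m)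
    {x u₁ u₂ : V} (hu₁ : u₁ ∈ W) (hu₂ : u₂ ∈ W) (h₁ : (openGraph (↑ω : BondConfig V)).Reachable x u₁)
    (h₂ : (openGraph (↑ω : BondConfig V)).Reachable x u₂) : u₁ = u₂ := by
  by_contra hne
  exact not_reachable_of_minimal hm hω hE hu₁ hu₂ hne (h₁.symm.trans h₂)

/-- **In a minimiser every vertex joined to `W` in `G` has a root**: a wired vertex reached by an
open path. [folklore] -/
theorem exists_root_of_minimal
    (hm : ∀ ω ⊆ G.edgeFinset, m ≤ #ω + 2 * clusterCount (↑ω : BondConfig V) W)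
    {ω : Finset (Sym2 V)} (hω : ω ⊆ G.edgeFinset) (hE : #ω + 2 * clusterCount (↑ω : BondConfig V) W = m)
    {v u : V} (hu : u ∈ W) (hvu : G.Reachable v u) :
    ∃ u' ∈ W, (openGraph (↑ω : BondConfig V)).Reachable v u' := by
  obtain ⟨p⟩ := reachable_of_reachable_of_minimal hm hω hE hvu
  exact exists_open_reachable_of_walk p hu

end Minimal

end KirchhoffSlope

end Summit.CriticalPhenomena.CardyFormulaZ2.Theorems
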